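import Literature.AlgebraicGeometry.GroupSchemes.CartierDualBlockReduction
import Literature.AlgebraicGeometry.GroupSchemes.IdempotentSplittingFixMap
import Literature.AlgebraicGeometry.GroupSchemes.GroupSchemeKernelAlg
import Literature.AlgebraicGeometry.GroupSchemes.HopfIdealOfClosedSubgroup
import Literature.AlgebraicGeometry.AbelianSchemes.AbelianSchemeOverRingAction
import Literature.AlgebraicGeometry.Motives.AbelianVarietyTorsion
import HarnessLib

/-!
# Block idempotents on a torsion layer: layer endomorphisms, their calculus, fixed layers and intersections as `T`-points
# ([Tate 1967] §2.2; [Tate 1997] (1.6)–(1.7), §(3.7); [Görtz–Wedhorn] Def. 4.45; [Mumford AV] §19, §20 (I))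

Topic `Literature/AlgebraicGeometry/GroupSchemes`; namespace `Literature.AlgebraicGeometry.GroupSchemes.TorsionLayer`.  THEOREMS ONLY (no
definition, no named fact, no instance, no notation, no `sorry`).  Cell `hodgecm-mathlib` (D-0151), FLOOR 0, P6 «MOD programme» (crux hLiu418 =
stmt-HodgeConjecture-24832, `--supports`, count-neutral): organ **(α) = (E2-ε)+(E2-fix) «CRT BLOCK IDEMPOTENTS ON A TORSION LAYER ∕ FIXED LAYERS AS
`T`-POINTS»** (LEAD F0P6-plan (g2) 2026-09-01T20:54:42Z ∕ 21:01:51Z; pen B-p04 (g39); cut F0P6b-plan (g3), MEMO-ED2 f97a8abc §1 (D-O)(D-ε)(D-W) and scoping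
21:08:16Z (T1)(T2)(T3)).  CONSUMERS: the P6b junction `bigBlockFrobeniusLaw_of_heads` (`Lines/F0_P6b_FrobeniusLagrangian` ⊕ `Lines/F0_P6b_WeilCartierDuality`,
letter (BLF) `BlockLagrangianFrobenius`, body ★ `CartierDualBlockReduction.blockReduction`) — whose binders `(β : O → (G ⟶ G)) [∀ a, IsMonHom (β a)]
(hβ : β a ≫ j = j ≫ act a)`, `β εū ≫ β εū = β εū`, `β εu ≫ β εu = β εu`, `star εu = εū`, `star εū = εu` and the instance blocks + readings `hW`, `h𝒢`,
`hΦ𝒢` of the fixed layers `W`, `𝒢l` and of `Φ𝒢 = Φ ∩ 𝒢l` are PRODUCED here — and ★ p846791 (E2-asm) `AbelianVarietyKernelLawBlockAssembly` (its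
`hβone`, `hβadd`, `hN`).  HC_CM is proved only modulo the printed citations until rung 0 closes; this file is generic and changes no count.

THE MATHEMATICS.  ([Tate1997FiniteFlatGroupSchemes] (1.6)–(1.7): group schemes as group functors, subgroups by their `T`-points; [GortzWedhorn2020]
Def. 4.45 (2): kernels as fibre products with the unit section.)  Let `j : G ↪ X` be a monomorphic homomorphism of group objects reading
`G = X[N]` on `T`-points (`t` factors through `j` iff `t ≫ [N]_X = 1`, `[N]_X = (𝟙 X)^N` the pointwise power).  Every homomorphism `u : X → X`
commutes with `[N]` (`[N] ≫ u = u^N = u ≫ [N]`), so `j ≫ u` is killed by `[N]` and factors UNIQUELY as `β_u ≫ j` — the LAYER ENDOMORPHISM; `β_u`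
is a homomorphism (cancel the mono `j`), and `u ↦ β_u` respects identities, composition and pointwise products (§1), so a ring acting on `X`
(`ι(a+b) = ι(a)·ι(b)`, `ι(ab) = ι(b) ∘ ι(a)`, `ι(1) = id`: [MumfordAV1970] §19, ★ `RingAction`) acts on `G` by `β`, with `β(1) = 𝟙`, `β` additive and
multiplicative ([Tate1967] §2.2: `End` of the layers of a `p`-divisible group).  Since `[N]_G = 1` (pull `[N]_X ∘ j = 1` back along the mono `j`),
`β(N·c) = β(c)^N = 1`; hence an element `e` with `e² = e + N·c` — a CRT idempotent of `O ⧸ (N)`, [Neukirch1999] I (3.6) — acts by an IDEMPOTENT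
`β(e) ∘ β(e) = β(e)`, two such with `e e′ = N·c` act by ORTHOGONAL idempotents, and a ring involution `star` (complex conjugation on `𝒪_F`) carries
`e` to another such element `star e` with `star (star e) = e` (§4).  ([GortzWedhorn2020] Def. 4.45, ★ `IdempotentSplittingFiniteFlat`: the fixed layer
`Fix ε = Ker(𝟙 ∕ ε)`.)  A `T`-point `x` of `G` factors through `Fix ε ↪ G` iff `x ≫ ε = x` (§2); over a field, `Fix ε` of a finite commutative
`G` is again a finite commutative closed subgroup scheme — affine with finite free affine algebra, the INSTANCE BLOCK (BLF) quantifies over — and so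
is the intersection `Φ ∩ 𝒢l := Ker(j𝒢 ≫ χ)` of a fixed layer `j𝒢 : 𝒢l ↪ G` with a kernel `Φ = Ker χ` (§3; [Tate1997FiniteFlatGroupSchemes] §(3.7):
closed subgroups of finite group schemes over a field are finite).

* §0 (any cartesian monoidal `C`) `isCommMonObj_of_mono` — commutativity descends along a monomorphic homomorphism.
* §1 (any cartesian monoidal `C`; `j : G ⟶ X` mono homomorphism, `β ≫ j = j ≫ u`) LAYER ENDOMORPHISMS: `layerEnd_unique`, `layerEnd_id`, `layerEnd_comp`,
  `layerEnd_mul_pointwise`, `layerEnd_one_pointwise`, `isMonHom_layerEnd`; for a family `β : O → (G ⟶ G)` over `act : O → (X ⟶ X)`: **`layerEnd_add`**,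
  **`layerEnd_mul`**, **`layerEnd_one`**, `layerEnd_zero`, `layerEnd_comm`, `layerEnd_nsmul`; torsion: **`pow_id_eq_one_of_layer`** (`[N]_G = 1`),
  `layerEnd_eq_of_eq_add_nsmul`, **`layerEnd_idem_of_mul_self_eq`** (`e² = e + N•c ⇒ β e ≫ β e = β e`), `layerEnd_comp_eq_one_of_mul_eq_nsmul`;
  existence: `exists_layerEnd_of_comm`, **`exists_layerEnd`** (the family `β` with `IsMonHom` and `hβ`, one `obtain`).
* §2 FIXED LAYERS: `exists_comp_fixι_eq_iff` (any base; (BLF) `hW`∕`h𝒢` verbatim), `finite_alg_of_isClosedImmersion`, `isAffine_fix_left`, `finite_alg_fix`,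
  and over a field the one-`obtain` package **`exists_fixedLayer`** (instance block + inclusion + reading).
* §3 INTERSECTION WITH A KERNEL: **`exists_interLayer`** (`Φ𝒢 := Ker(j𝒢 ≫ χ)`, instance block, `(∃ s, s ≫ φ𝒢 = y) ↔ y ≫ j𝒢 ≫ χ = 1`) and the
  (BLF)-literal **`exists_interLayer_of_reading`** (`… ↔ ∃ s′, s′ ≫ φ = y ≫ j𝒢` for any realisation `φ` of `Ker χ`).
* §4 STAR TRANSPORT (ring side; `εū := star εu`, so `star εu = εū` is `rfl` and `star εū = εu` is the involution): `mul_self_eq_add_nsmul_star`, `mul_eq_nsmul_star`, `sub_one_mem_star`, `mem_star`.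
* §5 DRESS: `exists_layerEnd_ringAction` (★ `AbelianSchemeOver.RingAction`: `β` with `hβ`, `β 1 = 𝟙`, additive, multiplicative, `[N]_G = 1`) and
  `exists_layerEnd_abelianVariety` ((BLF)'s `hG` with `((N : ℕ) : ℤ) • 𝟙 A`, ★ `hom_zsmul_id`).

## References
* [Tate1967] J. T. Tate, *p-divisible groups*, Proc. Conf. Local Fields (Driebergen 1966), Springer 1967, §2.2.
* [Tate1997FiniteFlatGroupSchemes] J. Tate, *Finite flat group schemes*, in: Modular Forms and Fermat's Last Theorem (1997), (1.6)–(1.7) p. 122, §(3.7).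
* [GortzWedhorn2020] U. Görtz, T. Wedhorn, *Algebraic Geometry I* (2nd ed. 2020), Definition 4.45 (2) (p. 117).
* [MumfordAV1970] D. Mumford, *Abelian Varieties* (1970), §19 (first paragraph), §20 (I) (p. 189).
* [Neukirch1999] J. Neukirch, *Algebraic Number Theory* (1999), Ch. I §3 (3.6) (Chinese remainder theorem).
-/

set_option autoImplicit false

-- Mathlib's `Over`/`Scheme` APIs are stated across semireducible wrappers (as in the ★ `GroupSchemes/*` files).
set_option backward.isDefEq.respectTransparency false

noncomputable section

universe v u

open CategoryTheory CategoryTheory.Limits AlgebraicGeometry MonoidalCategory CartesianMonoidalCategory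
open scoped MonObj

namespace Literature.AlgebraicGeometry.GroupSchemes.TorsionLayer

open Literature.AlgebraicGeometry.Motives Literature.AlgebraicGeometry.GroupSchemes.GroupSchemeKernel
  Literature.AlgebraicGeometry.GroupSchemes.IdempotentSplitting Literature.AlgebraicGeometry.GroupSchemes.AffineGroupScheme

/-! ## §0 Commutativity descends along a monomorphic homomorphism -/

section Comm

variable {C : Type u} [Category.{v} C] [CartesianMonoidalCategory C] [BraidedCategory C]

/-- **A subgroup object of a commutative group object is commutative**: if `i : K → G` is a monomorphic homomorphism and `G` is commutative,
so is `K` (commutativity of `T`-points is inherited along the injective maps `Hom(T, K) → Hom(T, G)`; Mathlib `isCommMonObj_iff_isMulCommutative`).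
[cite: Tate1997FiniteFlatGroupSchemes, (1.6)–(1.7) p. 122] -/
theorem isCommMonObj_of_mono {K G : C} [MonObj K] [MonObj G] [IsCommMonObj G] (i : K ⟶ G) [IsMonHom i] [Mono i] : IsCommMonObj K := by
  rw [isCommMonObj_iff_isMulCommutative]
  intro T
  haveI := (isCommMonObj_iff_isMulCommutative G).1 inferInstance T
  refine ⟨⟨fun a b => ?_⟩⟩
  rw [← cancel_mono i, MonObj.mul_comp, MonObj.mul_comp, mul_comm]

end Comm

/-! ## §1 Layer endomorphisms over a monomorphic homomorphism `j : G ⟶ X` -/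

section LayerEnd

variable {C : Type u} [Category.{v} C]

/-- **Uniqueness of the layer endomorphism**: two morphisms `β`, `β′ : G → G` over the same `u` (`β ≫ j = j ≫ u`) are equal (`j` mono).
[cite: Tate1997FiniteFlatGroupSchemes, (1.6)–(1.7) p. 122] -/
theorem layerEnd_unique {X G : C} (j : G ⟶ X) [Mono j] {u : X ⟶ X} {β β' : G ⟶ G} (hβ : β ≫ j = j ≫ u) (hβ' : β' ≫ j = j ≫ u) : β = β' := by
  rw [← cancel_mono j, hβ, hβ']

/-- `𝟙 G` lies over `𝟙 X`. [cite: Tate1997FiniteFlatGroupSchemes, (1.6)–(1.7) p. 122] -/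
theorem layerEnd_id {X G : C} (j : G ⟶ X) : 𝟙 G ≫ j = j ≫ 𝟙 X := by
  rw [Category.id_comp, Category.comp_id]

/-- Layer endomorphisms COMPOSE over composites: `βa` over `u`, `βb` over `w` ⟹ `βa ≫ βb` over `u ≫ w`. [cite: Tate1997FiniteFlatGroupSchemes, (1.6)–(1.7) p. 122] -/
theorem layerEnd_comp {X G : C} (j : G ⟶ X) {u w : X ⟶ X} {βa βb : G ⟶ G} (ha : βa ≫ j = j ≫ u) (hb : βb ≫ j = j ≫ w) :
    (βa ≫ βb) ≫ j = j ≫ (u ≫ w) := by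
  rw [Category.assoc, hb, ← Category.assoc, ha, Category.assoc]

/-- Layer endomorphisms MULTIPLY POINTWISE over pointwise products (`j` a homomorphism): `βa` over `u`, `βb` over `w` ⟹ `βa · βb` over `u · w`
(Mathlib `MonObj.mul_comp` ∕ `MonObj.comp_mul`). [cite: MumfordAV1970, §19 (first paragraph)] -/
theorem layerEnd_mul_pointwise [CartesianMonoidalCategory C] {X G : C} [MonObj X] [MonObj G] (j : G ⟶ X) [IsMonHom j] {u w : X ⟶ X}
    {βa βb : G ⟶ G} (ha : βa ≫ j = j ≫ u) (hb : βb ≫ j = j ≫ w) : (βa * βb) ≫ j = j ≫ (u * w) := by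
  rw [MonObj.mul_comp, ha, hb, MonObj.comp_mul]

/-- The trivial endomorphism `1 : G → G` lies over `1 : X → X` (`j` a homomorphism). [cite: MumfordAV1970, §19 (first paragraph)] -/
theorem layerEnd_one_pointwise [CartesianMonoidalCategory C] {X G : C} [MonObj X] [MonObj G] (j : G ⟶ X) [IsMonHom j] :
    (1 : G ⟶ G) ≫ j = j ≫ (1 : X ⟶ X) := by
  rw [MonObj.one_comp, MonObj.comp_one]

/-- **A layer endomorphism over a homomorphism is a homomorphism** (`β ≫ j = j ≫ u` with `j`, `u` homomorphisms, `j` mono; ★ `isMonHom_of_comp_mono`).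
[cite: Tate1997FiniteFlatGroupSchemes, (1.6)–(1.7) p. 122] -/
theorem isMonHom_layerEnd [CartesianMonoidalCategory C] {X G : C} [MonObj X] [MonObj G] (j : G ⟶ X) [IsMonHom j] [Mono j] {u : X ⟶ X}
    [IsMonHom u] {β : G ⟶ G} (hβ : β ≫ j = j ≫ u) : IsMonHom β := by
  haveI : IsMonHom (β ≫ j) := by rw [hβ]; infer_instance
  exact isMonHom_of_comp_mono β j

/-! ### A family `β : O → End G` over a family `act : O → End X` -/

/-- **`β` is ADDITIVE when `act` is**: `act (a + b) = act a · act b` (pointwise product) ⟹ `β (a + b) = β a · β b` — the `hβadd` of ★ (E2-asm)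
`comp_eq_one_iff_forall_block`. [cite: Tate1967, §2.2] [cite: MumfordAV1970, §19 (first paragraph)] -/
theorem layerEnd_add [CartesianMonoidalCategory C] {X G : C} [MonObj X] [MonObj G] (j : G ⟶ X) [IsMonHom j] [Mono j] {O : Type*} [Add O]
    (act : O → (X ⟶ X)) (β : O → (G ⟶ G)) (hβ : ∀ a, β a ≫ j = j ≫ act a) {a b : O} (hadd : act (a + b) = act a * act b) :
    β (a + b) = β a * β b :=
  layerEnd_unique j (hβ (a + b)) (by rw [hadd]; exact layerEnd_mul_pointwise j (hβ a) (hβ b))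

/-- **`β` is MULTIPLICATIVE when `act` is**: `act (a * b) = act b ≫ act a` (★ `RingAction.i_mul` convention) ⟹ `β (a * b) = β b ≫ β a`. [cite: Tate1967, §2.2] -/
theorem layerEnd_mul {X G : C} (j : G ⟶ X) [Mono j] {O : Type*} [Mul O] (act : O → (X ⟶ X)) (β : O → (G ⟶ G)) (hβ : ∀ a, β a ≫ j = j ≫ act a)
    {a b : O} (hmul : act (a * b) = act b ≫ act a) : β (a * b) = β b ≫ β a :=
  layerEnd_unique j (hβ (a * b)) (by rw [hmul]; exact layerEnd_comp j (hβ b) (hβ a))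

/-- **`β 1 = 𝟙`** when `act 1 = 𝟙` — the `hβone` of ★ (E2-asm). [cite: Tate1967, §2.2] -/
theorem layerEnd_one {X G : C} (j : G ⟶ X) [Mono j] {O : Type*} [One O] (act : O → (X ⟶ X)) (β : O → (G ⟶ G)) (hβ : ∀ a, β a ≫ j = j ≫ act a)
    (hone : act 1 = 𝟙 X) : β 1 = 𝟙 G :=
  layerEnd_unique j (hβ 1) (by rw [hone]; exact layerEnd_id j)

/-- `β 0 = 1` (the trivial endomorphism) when `act 0 = 1`. [cite: Tate1967, §2.2] -/
theorem layerEnd_zero [CartesianMonoidalCategory C] {X G : C} [MonObj X] [MonObj G] (j : G ⟶ X) [IsMonHom j] [Mono j] {O : Type*} [Zero O]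
    (act : O → (X ⟶ X)) (β : O → (G ⟶ G)) (hβ : ∀ a, β a ≫ j = j ≫ act a) (hzero : act 0 = 1) : β 0 = 1 :=
  layerEnd_unique j (hβ 0) (by rw [hzero]; exact layerEnd_one_pointwise j)

/-- **Layer endomorphisms of a COMMUTATIVE ring action commute**: `act (a * b) = act b ≫ act a` for all `a b` ⟹ `β a ≫ β b = β b ≫ β a`. [cite: Tate1967, §2.2] -/
theorem layerEnd_comm {X G : C} (j : G ⟶ X) [Mono j] {O : Type*} [CommMagma O] (act : O → (X ⟶ X)) (β : O → (G ⟶ G))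
    (hβ : ∀ a, β a ≫ j = j ≫ act a) (hmul : ∀ a b : O, act (a * b) = act b ≫ act a) (a b : O) : β a ≫ β b = β b ≫ β a := by
  rw [← layerEnd_mul j act β hβ (hmul b a), ← layerEnd_mul j act β hβ (hmul a b), mul_comm]

/-- An additive `β` turns multiples into pointwise powers: `β (n • c) = (β c) ^ n` (given only `β (a + b) = β a · β b`, which forces `β 0 = 1`).
[cite: Tate1967, §2.2] -/
theorem layerEnd_nsmul [CartesianMonoidalCategory C] {G : C} [GrpObj G] {O : Type*} [AddMonoid O] (β : O → (G ⟶ G))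
    (hadd : ∀ a b : O, β (a + b) = β a * β b) (n : ℕ) (c : O) : β (n • c) = β c ^ n := by
  induction n with
  | zero =>
    rw [zero_smul, pow_zero]
    have h := hadd 0 0
    rw [add_zero] at h
    exact mul_eq_left.mp h.symm
  | succ n ih => rw [succ_nsmul, hadd, ih, pow_succ]

/-! ### The `N`-torsion layer: `[N]_G = 1`, idempotents modulo `N` -/

/-- **`[N]_G = 1` ON THE `N`-TORSION LAYER**: if `j ≫ [N]_X = 1` (e.g. `G = X[N]`) then `(𝟙 G) ^ N = 1` (`(𝟙 G)^N ≫ j = j^N = j ≫ (𝟙 X)^N = 1`,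
cancel the mono `j`) — the `hN` of ★ (E2-asm) `comp_eq_one_iff_forall_block_of_torsion`. [cite: Tate1967, §2.2] [cite: GortzWedhorn2020, Definition 4.45 (2) (p. 117)] -/
theorem pow_id_eq_one_of_layer [CartesianMonoidalCategory C] {X G : C} [MonObj X] [MonObj G] (j : G ⟶ X) [IsMonHom j] [Mono j] {N : ℕ}
    (hj : j ≫ (𝟙 X) ^ N = 1) : (𝟙 G) ^ N = 1 := by
  rw [← cancel_mono j, MonObj.pow_comp, Category.id_comp, MonObj.one_comp]
  rw [MonObj.comp_pow, Category.comp_id] at hj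
  exact hj

/-- On a layer with `[N]_G = 1`, an additive `β` does not see multiples of `N`: `e′ = e + N • c ⟹ β e′ = β e` (`β (N • c) = (β c)^N = β c ≫ [N]_G = 1`).
[cite: Tate1967, §2.2] -/
theorem layerEnd_eq_of_eq_add_nsmul [CartesianMonoidalCategory C] {G : C} [GrpObj G] {O : Type*} [AddMonoid O] (β : O → (G ⟶ G))
    (hadd : ∀ a b : O, β (a + b) = β a * β b) {N : ℕ} (hN : (𝟙 G) ^ N = 1) {e e' c : O} (h : e' = e + N • c) : β e' = β e := by
  have hpow : β c ^ N = 1 := by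
    rw [← Category.comp_id (β c), ← MonObj.comp_pow, hN, MonObj.comp_one]
  rw [h, hadd, layerEnd_nsmul β hadd, hpow, mul_one]

/-- **A CRT IDEMPOTENT ACTS BY AN IDEMPOTENT ON THE `N`-TORSION LAYER**: for `β` additive and anti-multiplicative (`β (a * b) = β b ≫ β a`) on a
layer with `[N]_G = 1`, an element `e` with `e * e = e + N • c` (idempotent modulo `N`) has `β e ≫ β e = β e` — the two idempotency hypotheses of
(BLF) ∕ ★ `blockReduction`. [cite: Tate1967, §2.2] [cite: Neukirch1999, Ch. I §3 (3.6)] -/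
theorem layerEnd_idem_of_mul_self_eq [CartesianMonoidalCategory C] {G : C} [GrpObj G] {O : Type*} [NonUnitalNonAssocSemiring O]
    (β : O → (G ⟶ G)) (hadd : ∀ a b : O, β (a + b) = β a * β b) (hmul : ∀ a b : O, β (a * b) = β b ≫ β a) {N : ℕ} (hN : (𝟙 G) ^ N = 1)
    {e c : O} (he : e * e = e + N • c) : β e ≫ β e = β e := by
  rw [← hmul, layerEnd_eq_of_eq_add_nsmul β hadd hN he]

/-- **ORTHOGONALITY**: if `e * e′ = N • c` then `β e′ ≫ β e = 1` on a layer with `[N]_G = 1` (`β (N • c) = 1`). [cite: Tate1967, §2.2] -/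
theorem layerEnd_comp_eq_one_of_mul_eq_nsmul [CartesianMonoidalCategory C] {G : C} [GrpObj G] {O : Type*} [NonUnitalNonAssocSemiring O]
    (β : O → (G ⟶ G)) (hadd : ∀ a b : O, β (a + b) = β a * β b) (hmul : ∀ a b : O, β (a * b) = β b ≫ β a) {N : ℕ} (hN : (𝟙 G) ^ N = 1)
    {e e' c : O} (h : e * e' = N • c) : β e' ≫ β e = 1 := by
  have h0 : β 0 = 1 := by
    have h00 := hadd 0 0
    rw [add_zero] at h00
    exact mul_eq_left.mp h00.symm
  rw [← hmul, layerEnd_eq_of_eq_add_nsmul β hadd hN (show e * e' = 0 + N • c by rw [zero_add, h]), h0]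

/-! ### Existence of layer endomorphisms on `G = X[N]` -/

/-- **RESTRICTION TO THE LAYER of an endomorphism commuting with the pin**: if `G ↪ X` reads `t ∈ G ↔ t ≫ φ = 1` for some `φ : X → Y` and `u : X → X`
satisfies `u ≫ φ = φ ≫ u′` with `u′` a homomorphism, then `j ≫ u` factors through `j`: `∃ β, β ≫ j = j ≫ u` (and `β` is a homomorphism if `u`, `j` are,
`isMonHom_layerEnd`). [cite: Tate1997FiniteFlatGroupSchemes, (1.6)–(1.7) p. 122] -/
theorem exists_layerEnd_of_comm [CartesianMonoidalCategory C] {X G Y : C} [MonObj Y] (j : G ⟶ X) (φ : X ⟶ Y)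
    (hG : ∀ ⦃T : C⦄ (t : T ⟶ X), (∃ s : T ⟶ G, s ≫ j = t) ↔ t ≫ φ = 1) (u : X ⟶ X) (u' : Y ⟶ Y) [IsMonHom u'] (hu : u ≫ φ = φ ≫ u') :
    ∃ β : G ⟶ G, β ≫ j = j ≫ u := by
  have hj : j ≫ φ = 1 := (hG j).1 ⟨𝟙 G, Category.id_comp _⟩
  exact (hG (j ≫ u)).2 (by rw [Category.assoc, hu, ← Category.assoc, hj, MonObj.one_comp])

/-- **THE LAYER ENDOMORPHISMS OF A FAMILY OF HOMOMORPHISMS ON `G = X[N]`** (one `obtain`): for a mono homomorphism `j : G → X` reading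
`t ∈ G ↔ t ≫ [N]_X = 1` and homomorphisms `act a : X → X` (`a ∈ O`), there is `β : O → End G` with every `β a` a HOMOMORPHISM and `β a ≫ j = j ≫ act a`
— the binders `β`, `[∀ a, IsMonHom (β a)]`, `hβ` of (BLF).  (`[N]_X ≫ act a = (act a)^N = act a ≫ [N]_X`.) [cite: Tate1967, §2.2]
[cite: Tate1997FiniteFlatGroupSchemes, (1.6)–(1.7) p. 122] -/
theorem exists_layerEnd [CartesianMonoidalCategory C] {X G : C} [MonObj X] [MonObj G] (j : G ⟶ X) [IsMonHom j] [Mono j] (N : ℕ)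
    (hG : ∀ ⦃T : C⦄ (t : T ⟶ X), (∃ s : T ⟶ G, s ≫ j = t) ↔ t ≫ (𝟙 X) ^ N = 1) {O : Type*} (act : O → (X ⟶ X)) [∀ a, IsMonHom (act a)] :
    ∃ β : O → (G ⟶ G), (∀ a, IsMonHom (β a)) ∧ ∀ a, β a ≫ j = j ≫ act a := by
  have h : ∀ a, ∃ β : G ⟶ G, β ≫ j = j ≫ act a := fun a =>
    exists_layerEnd_of_comm j ((𝟙 X) ^ N) hG (act a) (act a) (by rw [MonObj.comp_pow, Category.comp_id, MonObj.pow_comp, Category.id_comp])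
  choose β hβ using h
  exact ⟨β, fun a => isMonHom_layerEnd j (hβ a), hβ⟩

end LayerEnd

/-! ## §2 Fixed layers as `T`-points; the instance block over a field -/

section Fixed

variable {S : Scheme.{u}} {G : Over S} [GrpObj G] (ε : G ⟶ G)

/-- **POINTS OF THE FIXED LAYER: `x` factors through `Fix ε ↪ G` iff `x ≫ ε = x`** — the readings `hW`, `h𝒢` of (BLF) ∕ ★ `blockReduction` verbatim
(★ `fixLift`, ★ `fixι_comp`; any base, any endomorphism `ε`). [cite: GortzWedhorn2020, Definition 4.45 (2) (p. 117)] -/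
theorem exists_comp_fixι_eq_iff {T : Over S} (x : T ⟶ G) : (∃ s : T ⟶ fix ε, s ≫ fixι ε = x) ↔ x ≫ ε = x := by
  constructor
  · rintro ⟨s, rfl⟩
    rw [Category.assoc, fixι_comp]
  · intro hx
    exact ⟨fixLift ε x hx, fixLift_ι ε x hx⟩

end Fixed

section Affine

variable {R : Type u} [CommRing R]

/-- **A closed subscheme of an affine `R`-scheme with finite affine algebra has finite affine algebra** (`Γ(K) ≅ Γ(G) ⧸ ker Γ(i)`, ★
`exists_algEquiv_quotient_ker_appTop`). [cite: Tate1997FiniteFlatGroupSchemes, §(3.7)] -/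
theorem finite_alg_of_isClosedImmersion {K G : SchemeOver R} [IsAffine K.left] [IsAffine G.left] (i : K ⟶ G) [IsClosedImmersion i.left]
    [Module.Finite R (Alg G)] : Module.Finite R (Alg K) := by
  obtain ⟨e, -⟩ := exists_algEquiv_quotient_ker_appTop i
  exact Module.Finite.equiv e.toLinearEquiv

variable {G : SchemeOver R} [GrpObj G] [IsAffine G.left] (ε : G ⟶ G)

/-- **`Fix ε` is affine** for affine `G` (`Fix ε = Ker(𝟙 ∕ ε)`, ★ `isAffine_ker_left`). [cite: GortzWedhorn2020, Definition 4.45 (2) (p. 117)] -/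
theorem isAffine_fix_left : IsAffine (fix ε).left :=
  isAffine_ker_left ((𝟙 G) / ε)

/-- **`Γ(Fix ε)` is a finite `R`-module** when `Γ(G)` is (closed subscheme of the affine `G`). [cite: Tate1997FiniteFlatGroupSchemes, §(3.7)] -/
theorem finite_alg_fix [Module.Finite R (Alg G)] : Module.Finite R (Alg (fix ε)) := by
  haveI := isAffine_fix_left ε
  haveI : IsClosedImmersion (fixι ε).left := isClosedImmersion_fixι_left ε
  exact finite_alg_of_isClosedImmersion (fixι ε)

end Affine

section Field

variable {k : Type u} [Field k]

/-- **THE FIXED LAYER OF AN ENDOMORPHISM OF A FINITE COMMUTATIVE GROUP SCHEME OVER A FIELD, AS (BLF) QUANTIFIES IT** (one `obtain`): for a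
homomorphism `ε : G → G` of a commutative `k`-group scheme `G` which is affine with finite affine algebra, there is a `k`-group scheme `W` —
commutative, affine, `Γ(W)` finite free — with a homomorphism `jW : W → G`, a closed immersion, such that a `T`-point `x` of `G` factors through
`jW` iff `x ≫ ε = x`.  (`W := Fix ε` of ★ `IdempotentSplittingFiniteFlat` with its structure `fixGrpObj`; idempotency of `ε` is NOT needed for the
reading.) [cite: GortzWedhorn2020, Definition 4.45 (2) (p. 117)] [cite: Tate1997FiniteFlatGroupSchemes, §(3.7)] -/
theorem exists_fixedLayer (G : SchemeOver k) [GrpObj G] [IsCommMonObj G] [IsAffine G.left] [Module.Finite k (Alg G)] (ε : G ⟶ G) [IsMonHom ε] :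
    ∃ (W : SchemeOver k) (_ : GrpObj W) (_ : IsCommMonObj W) (_ : IsAffine W.left) (_ : Module.Free k (Alg W)) (_ : Module.Finite k (Alg W))
      (jW : W ⟶ G) (_ : IsMonHom jW) (_ : IsClosedImmersion jW.left),
      ∀ ⦃T : SchemeOver k⦄ (x : T ⟶ G), (∃ s : T ⟶ W, s ≫ jW = x) ↔ x ≫ ε = x := by
  letI := fixGrpObj ε
  haveI := isAffine_fix_left ε
  haveI := finite_alg_fix ε
  exact ⟨fix ε, fixGrpObj ε, isCommMonObj_fix ε, inferInstance, inferInstance, inferInstance, fixι ε, isMonHom_fixι ε,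
    isClosedImmersion_fixι_left ε, fun _ x => exists_comp_fixι_eq_iff ε x⟩

/-! ## §3 The intersection of a closed subgroup with a kernel -/

/-- **THE PART OF A CLOSED SUBGROUP KILLED BY A HOMOMORPHISM, AS (BLF) QUANTIFIES IT** (one `obtain`): for a commutative `k`-group scheme `𝒢l`,
affine with finite affine algebra (a fixed layer `j𝒢 : 𝒢l ↪ G`, say), and a homomorphism `χ : 𝒢l → H` to a separated `k`-group scheme (say
`χ = j𝒢 ≫ j ≫ F^{(r)}_{A∕k}`), there is a `k`-group scheme `Φ𝒢` — commutative, affine, `Γ(Φ𝒢)` finite free — with a homomorphism and closed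
immersion `φ𝒢 : Φ𝒢 → 𝒢l` such that a `T`-point `y` of `𝒢l` factors through `φ𝒢` iff `y ≫ χ = 1`.  (`Φ𝒢 := Ker χ`, ★ `GroupSchemeKernel`.)
[cite: GortzWedhorn2020, Definition 4.45 (2) (p. 117)] [cite: Tate1997FiniteFlatGroupSchemes, §(3.7)] -/
theorem exists_interLayer (𝒢l : SchemeOver k) [GrpObj 𝒢l] [IsCommMonObj 𝒢l] [IsAffine 𝒢l.left] [Module.Finite k (Alg 𝒢l)]
    {H : SchemeOver k} [GrpObj H] [IsSeparated H.hom] (χ : 𝒢l ⟶ H) [IsMonHom χ] :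
    ∃ (Φ𝒢 : SchemeOver k) (_ : GrpObj Φ𝒢) (_ : IsCommMonObj Φ𝒢) (_ : IsAffine Φ𝒢.left) (_ : Module.Free k (Alg Φ𝒢)) (_ : Module.Finite k (Alg Φ𝒢))
      (φ𝒢 : Φ𝒢 ⟶ 𝒢l) (_ : IsMonHom φ𝒢) (_ : IsClosedImmersion φ𝒢.left),
      ∀ ⦃T : SchemeOver k⦄ (y : T ⟶ 𝒢l), (∃ s : T ⟶ Φ𝒢, s ≫ φ𝒢 = y) ↔ y ≫ χ = 1 := by
  haveI : IsClosedImmersion (kerι χ).left := isClosedImmersion_kerι_left_of_isSeparated χ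
  haveI : IsAffine (ker χ).left := isAffine_left_of_isClosedImmersion (kerι χ)
  haveI : Module.Finite k (Alg (ker χ)) := finite_alg_of_isClosedImmersion (kerι χ)
  haveI : Mono (kerι χ) := mono_kerι χ
  exact ⟨ker χ, inferInstance, isCommMonObj_of_mono (kerι χ), inferInstance, inferInstance, inferInstance, kerι χ, inferInstance,
    inferInstance, fun _ y => exists_comp_kerι_eq_iff χ y⟩

/-- **(BLF)-LITERAL FORM `Φ𝒢 = Φ ∩ 𝒢l`**: with `χ : G → H` a homomorphism to a separated `k`-group scheme whose kernel is REALISED by `φ : Φ → G`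
(`(∃ s′, s′ ≫ φ = t) ↔ t ≫ χ = 1` for all `T`-points — e.g. `Φ = A[F_q] ↪ G = A[q]`, ★ `exists_closedImmersion_ker_relFrobenius_ker_pow_zsmul_id`)
and a homomorphism `j𝒢 : 𝒢l → G` from a finite commutative `𝒢l`: there is `φ𝒢 : Φ𝒢 ↪ 𝒢l` (instance block as in `exists_interLayer`) with
`(∃ s, s ≫ φ𝒢 = y) ↔ ∃ s′, s′ ≫ φ = y ≫ j𝒢` — the binder `hΦ𝒢` of (BLF) ∕ ★ `blockReduction` verbatim. [cite: GortzWedhorn2020, Definition 4.45 (2) (p. 117)]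
[cite: Tate1997FiniteFlatGroupSchemes, §(3.7)] -/
theorem exists_interLayer_of_reading (𝒢l : SchemeOver k) [GrpObj 𝒢l] [IsCommMonObj 𝒢l] [IsAffine 𝒢l.left] [Module.Finite k (Alg 𝒢l)]
    {G H : SchemeOver k} [GrpObj G] [GrpObj H] [IsSeparated H.hom] (j𝒢 : 𝒢l ⟶ G) [IsMonHom j𝒢] (χ : G ⟶ H) [IsMonHom χ]
    {Φ : SchemeOver k} (φ : Φ ⟶ G) (hΦ : ∀ ⦃T : SchemeOver k⦄ (t : T ⟶ G), (∃ s' : T ⟶ Φ, s' ≫ φ = t) ↔ t ≫ χ = 1) :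
    ∃ (Φ𝒢 : SchemeOver k) (_ : GrpObj Φ𝒢) (_ : IsCommMonObj Φ𝒢) (_ : IsAffine Φ𝒢.left) (_ : Module.Free k (Alg Φ𝒢)) (_ : Module.Finite k (Alg Φ𝒢))
      (φ𝒢 : Φ𝒢 ⟶ 𝒢l) (_ : IsMonHom φ𝒢) (_ : IsClosedImmersion φ𝒢.left),
      ∀ ⦃T : SchemeOver k⦄ (y : T ⟶ 𝒢l), (∃ s : T ⟶ Φ𝒢, s ≫ φ𝒢 = y) ↔ ∃ s' : T ⟶ Φ, s' ≫ φ = y ≫ j𝒢 := by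
  obtain ⟨Φ𝒢, i1, i2, i3, i4, i5, φ𝒢, i6, i7, h⟩ := exists_interLayer 𝒢l (j𝒢 ≫ χ)
  refine ⟨Φ𝒢, i1, i2, i3, i4, i5, φ𝒢, i6, i7, fun T y => ?_⟩
  rw [h y, hΦ (y ≫ j𝒢), Category.assoc]

end Field

/-! ## §4 Star transport of an idempotent modulo `N` (ring side: `εū := star εu`) -/

section Star

variable {O : Type*} [CommRing O] (star : O →+* O)

/-- **`star` of an idempotent modulo `N` is idempotent modulo `N`**: `e * e = e + N • c ⟹ star e * star e = star e + N • star c` (`star` is a ring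
map). [cite: Neukirch1999, Ch. I §3 (3.6)] -/
theorem mul_self_eq_add_nsmul_star {e c : O} {N : ℕ} (he : e * e = e + N • c) : star e * star e = star e + N • star c := by
  rw [← map_mul, he, map_add, map_nsmul]

/-- `star` transports orthogonality modulo `N`: `e * e′ = N • c ⟹ star e * star e′ = N • star c`. [cite: Neukirch1999, Ch. I §3 (3.6)] -/
theorem mul_eq_nsmul_star {e e' c : O} {N : ℕ} (h : e * e' = N • c) : star e * star e' = N • star c := by
  rw [← map_mul, h, map_nsmul]

/-- `star` transports the CRT congruence «`e ≡ 1 (mod I)`» to «`star e ≡ 1 (mod J)`» whenever `star (I) ⊆ J` (e.g. `I = 𝔭_u^m`, `J = 𝔭_ū^m` for complex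
conjugation on `𝒪_F`). [cite: Neukirch1999, Ch. I §3 (3.6)] -/
theorem sub_one_mem_star {I J : Ideal O} (hIJ : ∀ a ∈ I, star a ∈ J) {e : O} (he : e - 1 ∈ I) : star e - 1 ∈ J := by
  have h := hIJ _ he
  rwa [map_sub, map_one] at h

/-- `star` transports «`e ≡ 0 (mod I)`» to «`star e ≡ 0 (mod J)`» whenever `star (I) ⊆ J`. [cite: Neukirch1999, Ch. I §3 (3.6)] -/
theorem mem_star {I J : Ideal O} (hIJ : ∀ a ∈ I, star a ∈ J) {e : O} (he : e ∈ I) : star e ∈ J :=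
  hIJ _ he

end Star

/-! ## §5 Dress: ring actions on abelian schemes, and the abelian-variety pin of (BLF) -/

section Dress

/-- **THE LAYER ACTION OF A RING ACTION ON AN ABELIAN SCHEME** (one `obtain`): for an abelian scheme `A → S` with a ring action `ι` of `O` (★
`RingAction`: `ι(ab) = ι(b) ≫ ι(a)`, `ι(a+b) = ι(a)·ι(b)`, `ι(1) = 𝟙`) and a mono homomorphism `j : G → A` reading `t ∈ G ↔ t ≫ [N]_A = 1`
(`[N]_A = (𝟙 A)^N`; ★ `mulN_eq_hom_zsmul_id` ∕ `hom_zsmul_id` convert), there is `β : O → End G` with: every `β a` a homomorphism, `β a ≫ j = j ≫ act.i a`,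
`β 1 = 𝟙`, `β` additive, `β` (anti-)multiplicative, and `[N]_G = 1` — the inputs of (BLF) (`β`, `hβ`) and of ★ (E2-asm) (`hβone`, `hβadd`, `hN`) at once;
idempotency ∕ orthogonality of `β e` for CRT elements `e` then by `layerEnd_idem_of_mul_self_eq` ∕ `layerEnd_comp_eq_one_of_mul_eq_nsmul`.
[cite: Tate1967, §2.2] [cite: MumfordAV1970, §19 (first paragraph)] -/
theorem exists_layerEnd_ringAction {S : Scheme.{u}} {A : Literature.AlgebraicGeometry.AbelianSchemes.AbelianSchemeOver S} {O : Type*} [CommRing O]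
    (act : A.RingAction O) {G : Over S} [GrpObj G] (j : G ⟶ A.X) [IsMonHom j] [Mono j] (N : ℕ)
    (hG : ∀ ⦃T : Over S⦄ (t : T ⟶ A.X), (∃ s : T ⟶ G, s ≫ j = t) ↔ t ≫ (𝟙 A.X) ^ N = 1) :
    ∃ β : O → (G ⟶ G), (∀ a, IsMonHom (β a)) ∧ (∀ a, β a ≫ j = j ≫ act.i a) ∧ β 1 = 𝟙 G ∧ (∀ a b, β (a + b) = β a * β b) ∧
      (∀ a b, β (a * b) = β b ≫ β a) ∧ (𝟙 G) ^ N = 1 := by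
  haveI := act.isMonHom
  obtain ⟨β, hβm, hβ⟩ := exists_layerEnd j N hG act.i
  exact ⟨β, hβm, hβ, layerEnd_one j act.i β hβ act.i_one, fun a b => layerEnd_add j act.i β hβ (act.i_add a b),
    fun a b => layerEnd_mul j act.i β hβ (act.i_mul a b), pow_id_eq_one_of_layer j ((hG j).1 ⟨𝟙 G, Category.id_comp _⟩)⟩

/-- **THE (BLF) PIN**: for an abelian variety `A∕k`, a closed subgroup `j : G ↪ A` reading `t ∈ G ↔ t ≫ (N • 𝟙 A) = 1` (the letter's `hG` with
`N = p^r`, additive notation of `Hom(A, A)`; ★ `hom_zsmul_id`) and ANY family `act : O → End(A)` of endomorphisms of the abelian variety (homomorphisms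
by definition), the layer endomorphisms exist: `β : O → End G`, homomorphisms, `β a ≫ j = j ≫ act a`; and `[N]_G = 1`.  The calculus of §1 then applies
to whatever identities `act` satisfies (`layerEnd_add`∕`_mul`∕`_one` with ★ `hom_hom_hom_add`). [cite: Tate1967, §2.2] [cite: MumfordAV1970, §19 (first paragraph)] -/
theorem exists_layerEnd_abelianVariety {k : Type u} [Field k] (A : AbelianVariety k) (N : ℕ) (G : SchemeOver k) [GrpObj G] (j : G ⟶ A.X) [IsMonHom j]
    [IsClosedImmersion j.left] (hG : ∀ ⦃T : SchemeOver k⦄ (t : T ⟶ A.X), (∃ s : T ⟶ G, s ≫ j = t) ↔ t ≫ (((N : ℤ) • 𝟙 A).hom.hom.hom) = 1)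
    {O : Type*} (act : O → (A ⟶ A)) :
    ∃ β : O → (G ⟶ G), (∀ a, IsMonHom (β a)) ∧ (∀ a, β a ≫ j = j ≫ (act a).hom.hom.hom) ∧ (𝟙 G) ^ N = 1 := by
  haveI : Mono j := Over.mono_of_mono_left j
  have hG' : ∀ ⦃T : SchemeOver k⦄ (t : T ⟶ A.X), (∃ s : T ⟶ G, s ≫ j = t) ↔ t ≫ (𝟙 A.X) ^ N = 1 := by
    intro T t
    rw [hG t, AbelianVariety.hom_zsmul_id, zpow_natCast]
  obtain ⟨β, hβm, hβ⟩ := exists_layerEnd j N hG' (fun a => (act a).hom.hom.hom)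
  exact ⟨β, hβm, hβ, pow_id_eq_one_of_layer j ((hG' j).1 ⟨𝟙 G, Category.id_comp _⟩)⟩

end Dress

end Literature.AlgebraicGeometry.GroupSchemes.TorsionLayer

end
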